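import Literature.NumberTheory.DiophantineGeometry.FunctionFieldConstantExtensionGenusProofs
import HarnessLib

/-!
# The fundamental equality `∑_{P'|P} e(P'|P) · deg P' = [F' : F] · deg P` (Stichtenoth Thm. 3.1.11)

Topic: `Literature/NumberTheory/DiophantineGeometry` (places `AlgFunctionField.PlaceOver` of a function
field `F/K`). Let `F'/F` be a finite extension of algebraic function fields over the SAME constant
field `K`, `P` a place of `F/K`, and for a place `P'` of `F'/K` above `P` (`P'.restrict = P`) let
`e(P'|P) = v_{P'}(π_P)` be its ramification index (`PlaceOver.ord_algebraMap_eq_mul`: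
`v_{P'}(y) = e(P'|P) v_P(y)`). We prove the **fundamental equality** in the form

  `∑_{P' | P} e(P'|P) · deg P' = [F' : F] · deg P`        (`sum_ramification_mul_degree_eq`)

which is [Stichtenoth 2009, Thm. 3.1.11] `∑ e_i f_i = [F' : F]` multiplied by `deg P`
(`deg P' = f(P'|P) deg P`); in this form no residue degree is needed. Proof (not the book's, which
uses integral bases; ours uses only theorems of the tree): by Riemann's inequality there is
`z ∈ F` whose only pole is `P`, say of order `a > 0`, so `a · deg P = deg (z)_∞ = [F : K(z)]`
(Thm. 1.4.11, `sum_neg_ord_mul_degree_eq_finrank`); in `F'` the poles of `z` are exactly the places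
above `P`, of orders `a · e(P'|P)`, so `a ∑ e(P'|P) deg P' = [F' : K(z)] = [F' : F] [F : K(z)]`.
Consequences: the places above `P` form a finite nonempty set (`finite_setOf_restrict_eq`,
`exists_restrict_eq'`), `deg P ≤ deg P'`, `e(P'|P) ≤ [F' : F]` (`ord_algebraMap_uniformizer_le_finrank`),
and a place with `e(P'|P) = [F' : F]` (total ramification) is the only place above `P` and has
`deg P' = deg P` (`eq_of_ord_algebraMap_uniformizer_eq_finrank`).

## References

* H. Stichtenoth, *Algebraic Function Fields and Codes*, 2nd ed., GTM 254, Springer 2009: Def. 3.1.5,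
  Prop. 3.1.4, Thm. 3.1.11, Thm. 1.4.11, Thm. 1.4.17. [Stichtenoth2009]
-/

noncomputable section

open scoped Classical IntermediateField

namespace Literature.NumberTheory.DiophantineGeometry.AlgFunctionField

namespace PlaceOver

universe u v

variable {K : Type u} {F : Type v} {F' : Type v} [Field K] [Field F] [Algebra K F]
variable [Field F'] [Algebra F F'] [Algebra K F'] [IsScalarTower K F F']
variable [IsAlgFunctionField K F] [FiniteDimensional F F']

/-! ### A function with a single pole -/

omit [Algebra F F'] [Algebra K F'] [IsScalarTower K F F'] [FiniteDimensional F F'] in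
/-- **A function whose only pole is `P`** (from Riemann's inequality, Stichtenoth Thm. 1.4.17 /
Prop. 1.6.6: `ℓ(nP) ≥ n deg P + 1 - g` exceeds `ℓ(0)` for `n` large, and an element of
`𝓛(nP) ∖ 𝓛(0)` has a pole, necessarily at `P`). Such a `z` is transcendental over `K`.
[cite: Stichtenoth2009, Prop. 1.6.6] -/
theorem exists_ord_neg_forall_ord_nonneg (P : PlaceOver K F) :
    ∃ z : F, z ≠ 0 ∧ P.ord z < 0 ∧ (∀ Q : PlaceOver K F, Q ≠ P → 0 ≤ Q.ord z) ∧
      Transcendental K z := by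
  haveI := fun D : Divisor K F => finiteDimensional_riemannRochSpace_holds (K := K) (F := F) D
  set l0 := ell (0 : Divisor K F) with hl0
  set n : ℕ := genus K F + l0 with hn
  set D : Divisor K F := Finsupp.single P (n : ℤ) with hD
  have hdegD : D.degree = n * (P.degree : ℤ) := by rw [hD, Divisor.degree_single]
  have hdegP : 1 ≤ (P.degree : ℤ) := by exact_mod_cast PlaceOver.degree_pos_holds P
  have hell := degree_add_one_sub_genus_le_ell (K := K) (F := F) D
  have hlt : ell (0 : Divisor K F) < ell D := by
    have : (l0 : ℤ) < ell D := by
      have h1 : (n : ℤ) ≤ n * (P.degree : ℤ) := by nlinarith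
      push_cast [hn] at h1 hell; rw [hdegD] at hell; push_cast [hn] at hell; omega
    exact_mod_cast this
  have hle : riemannRochSpace (0 : Divisor K F) ≤ riemannRochSpace D :=
    riemannRochSpace_mono (by
      rw [hD]; intro v
      by_cases hv : v = P
      · subst hv; simp
      · simp [Finsupp.single_eq_of_ne hv])
  obtain ⟨z, hzD, hz0⟩ := SetLike.exists_of_lt
    (Submodule.lt_of_le_of_finrank_lt_finrank hle (by simpa [ell] using hlt))
  have hzne : z ≠ 0 := fun h => hz0 (h ▸ zero_mem _)
  have hordD := (mem_riemannRochSpace_iff_ord_holds D hzne).1 hzD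
  have hQ : ∀ Q : PlaceOver K F, Q ≠ P → 0 ≤ Q.ord z := fun Q hQ => by
    simpa [hD, Finsupp.single_eq_of_ne hQ] using hordD Q
  have hP : P.ord z < 0 := by
    by_contra h
    push Not at h
    exact hz0 ((mem_riemannRochSpace_iff_ord_holds 0 hzne).2 fun v => by
      by_cases hv : v = P
      · subst hv; simpa using h
      · simpa using hQ v hv)
  refine ⟨z, hzne, hP, hQ, fun halg => ?_⟩
  have := P.ord_eq_zero_of_isAlgebraic hzne halg
  omega

/-! ### The places above `P` -/

/-- Poles are seen above and below alike: for `y ∈ F` and a place `P'` of `F'`,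
`v_{P'}(y) < 0 ↔ v_P(y) < 0` where `P = P' ∩ F` (`v_{P'}(y) = e(P'|P) v_P(y)`, `e ≥ 1`).
[cite: Stichtenoth2009, Prop. 3.1.4] -/
theorem ord_algebraMap_neg_iff (P' : PlaceOver K F') (y : F) :
    P'.ord (algebraMap F F' y) < 0 ↔ (P'.restrict (K := K) (F := F)).ord y < 0 := by
  rw [P'.ord_algebraMap_eq_mul (K := K) y]
  have he := P'.one_le_ord_algebraMap_uniformizer (K := K) (F := F)
  constructor
  · intro h
    by_contra h'
    push Not at h'
    exact absurd h (not_lt.2 (mul_nonneg (by omega) h'))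
  · intro h
    exact mul_neg_of_pos_of_neg (by omega) h

/-- **The places above `P` form a finite set** (they are among the poles of a function with a pole at
`P`; Stichtenoth Prop. 3.1.7 (b) / Cor. 1.3.4). [cite: Stichtenoth2009, Prop. 3.1.7(b)] -/
theorem finite_setOf_restrict_eq [IsAlgFunctionField K F'] (P : PlaceOver K F) :
    {P' : PlaceOver K F' | P'.restrict (K := K) (F := F) = P}.Finite := by
  obtain ⟨z, hz0, hzP, -, -⟩ := P.exists_ord_neg_forall_ord_nonneg
  refine (finite_setOf_ord_ne_zero_of_ne_zero (K := K) ((_root_.map_ne_zero (algebraMap F F')).2 hz0)).subset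
    fun P' hP' => ?_
  have : P'.ord (algebraMap F F' z) < 0 := (P'.ord_algebraMap_neg_iff z).2 (by rw [hP']; exact hzP)
  exact this.ne

/-- `𝒪_{P'} ∩ F = 𝒪_P` elementwise, for `P'` above `P`. [folklore] -/
theorem forall_mem_iff_of_restrict_eq {P' : PlaceOver K F'} {P : PlaceOver K F}
    (h : P'.restrict (K := K) (F := F) = P) (x : F) :
    algebraMap F F' x ∈ P'.toValuationSubring ↔ x ∈ P.toValuationSubring := by
  rw [← h]; exact (P'.mem_restrict_iff (K := K) (F := F) x).symm

/-- **`deg P ≤ deg P'`** for `P'` above `P`: the residue field `F_P` embeds `K`-linearly into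
`F'_{P'}` (Stichtenoth Def. 3.1.5: `f(P'|P) = [F'_{P'} : F_P] ≥ 1`). [cite: Stichtenoth2009, Def. 3.1.5] -/
theorem degree_le_degree_of_restrict_eq [IsAlgFunctionField K F'] {P' : PlaceOver K F'}
    {P : PlaceOver K F} (h : P'.restrict (K := K) (F := F) = P) : P.degree ≤ P'.degree := by
  haveI : FiniteDimensional K P'.residueField := PlaceOver.finiteDimensional_residueField_holds P'
  have hBP := forall_mem_iff_of_restrict_eq h
  set ρ := IsLocalRing.ResidueField.map (resHom P P' hBP) with hρ
  -- `ρ` is `K`-linear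
  have hρK : ∀ c : K, ρ (algebraMap K P.residueField c) = algebraMap K P'.residueField c := by
    intro c
    rw [PlaceOver.algebraMap_residueField_apply, PlaceOver.algebraMap_residueField_apply]
    change IsLocalRing.residue _ (resHom P P' hBP (algebraMap K P.toValuationSubring c)) = _
    congr 1
    apply Subtype.ext
    change algebraMap F F' (algebraMap K F c) = algebraMap K F' c
    exact (IsScalarTower.algebraMap_apply K F F' c).symm
  let ρl : P.residueField →ₗ[K] P'.residueField :=
    { toFun := ρ
      map_add' := fun a b => map_add ρ a b
      map_smul' := fun c a => by
        rw [RingHom.id_apply, Algebra.smul_def, Algebra.smul_def, map_mul, hρK] }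
  exact LinearMap.finrank_le_finrank_of_injective (f := ρl) (residueField_map_injective P P' hBP)

/-! ### The fundamental equality -/

omit [IsAlgFunctionField K F] [FiniteDimensional F F'] in
/-- `[F' : K(z)] = [F' : F] · [F : K(z)]` for `z ∈ F` (tower law, with `K(z) ⊆ F` identified with
`K(z) ⊆ F'`). [folklore] -/
theorem finrank_adjoin_algebraMap_eq_mul (z : F) [FiniteDimensional K⟮z⟯ F] [FiniteDimensional F F'] :
    Module.finrank K⟮algebraMap F F' z⟯ F' = Module.finrank F F' * Module.finrank K⟮z⟯ F := by
  set f : F →ₐ[K] F' := IsScalarTower.toAlgHom K F F' with hf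
  haveI : FiniteDimensional K⟮z⟯ F' := Module.Finite.trans F F'
  have hmap : K⟮z⟯.map f = K⟮algebraMap F F' z⟯ := by
    rw [IntermediateField.adjoin_map, Set.image_singleton]; rfl
  set e : K⟮z⟯ ≃ₐ[K] K⟮algebraMap F F' z⟯ :=
    (IntermediateField.equivMap K⟮z⟯ f).trans (IntermediateField.equivOfEq hmap) with he
  have hsmul : ∀ (c : K⟮z⟯) (x : F'), e c • x = c • x := by
    intro c x
    rw [show e c • x = ((e c : K⟮algebraMap F F' z⟯) : F') • x from rfl, smul_eq_mul,
      show c • x = (c : F) • x from rfl, Algebra.smul_def]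
    congr 1
  set b := Module.finBasis K⟮z⟯ F' with hb
  have h1 := Module.finrank_eq_card_basis (b.mapCoeffs e.toRingEquiv hsmul)
  rw [h1, ← Module.finrank_eq_card_basis b, ← Module.finrank_mul_finrank K⟮z⟯ F F', mul_comm]

/-- **The fundamental equality** `∑_{P'|P} e(P'|P) · deg P' = [F' : F] · deg P` for a finite
extension `F'/F` of function fields over `K` and a place `P` of `F` (Stichtenoth Thm. 3.1.11,
`∑ eᵢ fᵢ = n`, times `deg P`); here `S` is the (finite) set of places above `P` and
`e(P'|P) = v_{P'}(π_P)`. Proof by degrees of pole divisors of a function with `P` as its only pole.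
[cite: Stichtenoth2009, Thm. 3.1.11] -/
theorem sum_ramification_mul_degree_eq [IsAlgFunctionField K F'] (P : PlaceOver K F)
    (S : Finset (PlaceOver K F')) (hS : ∀ P', P' ∈ S ↔ P'.restrict (K := K) (F := F) = P) :
    ∑ P' ∈ S, P'.ord (algebraMap F F' (P.uniformizer : F)) * (P'.degree : ℤ) =
      Module.finrank F F' * (P.degree : ℤ) := by
  obtain ⟨z, hz0, hzP, hzQ, hzt⟩ := P.exists_ord_neg_forall_ord_nonneg
  haveI := IsAlgFunctionField.finiteDimensional_adjoin_simple hzt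
  -- in `F`: `a · deg P = [F : K(z)]`
  have hF := sum_neg_ord_mul_degree_eq_finrank hzt {P} (fun v hv => by
    by_contra hvP
    exact absurd hv (not_lt.2 (hzQ v (by simpa using hvP))))
  rw [Finset.filter_singleton, if_pos hzP, Finset.sum_singleton] at hF
  -- in `F'`: the poles of `z` are the places above `P`
  set z' := algebraMap F F' z with hz'
  have hzt' : Transcendental K z' :=
    (transcendental_algebraMap_iff (algebraMap F F').injective).2 hzt
  have hord : ∀ P' ∈ S, P'.ord z' = P'.ord (algebraMap F F' (P.uniformizer : F)) * P.ord z := by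
    intro P' hP'
    have h := P'.ord_algebraMap_eq_mul (K := K) z
    rwa [(hS P').1 hP'] at h
  have hF' := sum_neg_ord_mul_degree_eq_finrank hzt' S (fun P' hP' => by
    rw [hS]
    by_contra hne
    have h1 := (P'.ord_algebraMap_neg_iff (K := K) z).1 hP'
    exact absurd h1 (not_lt.2 (hzQ _ hne)))
  rw [Finset.filter_true_of_mem (fun P' hP' => by
    rw [hord P' hP']
    exact mul_neg_of_pos_of_neg (by
      have := P'.one_le_ord_algebraMap_uniformizer (K := K) (F := F)
      rw [(hS P').1 hP'] at this; omega) hzP)] at hF'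
  rw [finrank_adjoin_algebraMap_eq_mul z, Nat.cast_mul, ← hF] at hF'
  have hF'' : ∑ P' ∈ S, -(P'.ord (algebraMap F F' (P.uniformizer : F)) * P.ord z) * (P'.degree : ℤ) =
      Module.finrank F F' * (-P.ord z * (P.degree : ℤ)) := by
    rw [← hF']
    exact Finset.sum_congr rfl fun P' hP' => by rw [hord P' hP']
  -- cancel `a = -v_P(z) > 0`
  have ha : P.ord z ≠ 0 := hzP.ne
  have key : P.ord z * (∑ P' ∈ S, P'.ord (algebraMap F F' (P.uniformizer : F)) * (P'.degree : ℤ)) =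
      P.ord z * (Module.finrank F F' * (P.degree : ℤ)) := by
    rw [Finset.mul_sum]
    calc ∑ P' ∈ S, P.ord z * (P'.ord (algebraMap F F' (P.uniformizer : F)) * (P'.degree : ℤ))
        = -∑ P' ∈ S, -(P'.ord (algebraMap F F' (P.uniformizer : F)) * P.ord z) * (P'.degree : ℤ) := by
          rw [← Finset.sum_neg_distrib]; exact Finset.sum_congr rfl fun _ _ => by ring
      _ = -(Module.finrank F F' * (-P.ord z * (P.degree : ℤ))) := by rw [hF'']
      _ = P.ord z * (Module.finrank F F' * (P.degree : ℤ)) := by ring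
  exact mul_left_cancel₀ ha key

/-- The set of places above `P`, as a `Finset`. [folklore] -/
theorem mem_toFinset_restrict_eq_iff [IsAlgFunctionField K F'] (P : PlaceOver K F) (P' : PlaceOver K F') :
    P' ∈ (P.finite_setOf_restrict_eq (F' := F')).toFinset ↔ P'.restrict (K := K) (F := F) = P := by
  rw [Set.Finite.mem_toFinset]; rfl

/-- **Every place has a place above it** (Stichtenoth Prop. 3.1.7 (b)); unlike
`PlaceOver.exists_restrict_eq` no finiteness of the constant field is assumed (the fundamental equality
with an empty sum would give `[F' : F] deg P = 0`). [cite: Stichtenoth2009, Prop. 3.1.7(b)] -/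
theorem exists_restrict_eq' [IsAlgFunctionField K F'] (P : PlaceOver K F) :
    ∃ P' : PlaceOver K F', P'.restrict (K := K) (F := F) = P := by
  by_contra h
  push Not at h
  have hsum := P.sum_ramification_mul_degree_eq (F' := F') ∅ (fun P' => by simpa using h P')
  rw [Finset.sum_empty] at hsum
  have h1 : (0 : ℤ) < Module.finrank F F' := by exact_mod_cast Module.finrank_pos
  have h2 : (0 : ℤ) < P.degree := by exact_mod_cast PlaceOver.degree_pos_holds P
  nlinarith

/-- **`e(P'|P) ≤ [F' : F]`** (Stichtenoth Cor. 3.1.12 / Thm. 3.1.11: `e(P'|P) f(P'|P) ≤ ∑ eᵢfᵢ = [F':F]`).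
[cite: Stichtenoth2009, Thm. 3.1.11] -/
theorem ord_algebraMap_uniformizer_le_finrank [IsAlgFunctionField K F'] {P' : PlaceOver K F'}
    {P : PlaceOver K F} (h : P'.restrict (K := K) (F := F) = P) :
    P'.ord (algebraMap F F' (P.uniformizer : F)) ≤ Module.finrank F F' := by
  have hsum := P.sum_ramification_mul_degree_eq (F' := F') _ (P.mem_toFinset_restrict_eq_iff (F' := F'))
  have hmem : P' ∈ (P.finite_setOf_restrict_eq (F' := F')).toFinset :=
    (P.mem_toFinset_restrict_eq_iff P').2 h
  have hnonneg : ∀ Q ∈ (P.finite_setOf_restrict_eq (F' := F')).toFinset,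
      0 ≤ Q.ord (algebraMap F F' (P.uniformizer : F)) * (Q.degree : ℤ) := fun Q hQ => by
    have := Q.one_le_ord_algebraMap_uniformizer (K := K) (F := F)
    rw [(P.mem_toFinset_restrict_eq_iff Q).1 hQ] at this
    positivity
  have h1 := Finset.single_le_sum hnonneg hmem
  rw [hsum] at h1
  have h2 : (P.degree : ℤ) ≤ P'.degree := by exact_mod_cast degree_le_degree_of_restrict_eq h
  have h3 : (0 : ℤ) < P.degree := by exact_mod_cast PlaceOver.degree_pos_holds P
  have h4 : 0 ≤ P'.ord (algebraMap F F' (P.uniformizer : F)) := by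
    have := P'.one_le_ord_algebraMap_uniformizer (K := K) (F := F); rw [h] at this; omega
  nlinarith

/-- **Total ramification**: if `e(P'|P) = [F' : F]` then `P'` is the only place above `P` and
`deg P' = deg P` (Stichtenoth Def. 3.1.8 / Cor. of Thm. 3.1.11). [cite: Stichtenoth2009, Thm. 3.1.11] -/
theorem eq_of_ord_algebraMap_uniformizer_eq_finrank [IsAlgFunctionField K F'] {P' : PlaceOver K F'}
    {P : PlaceOver K F} (h : P'.restrict (K := K) (F := F) = P)
    (he : P'.ord (algebraMap F F' (P.uniformizer : F)) = Module.finrank F F') :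
    (∀ P'' : PlaceOver K F', P''.restrict (K := K) (F := F) = P → P'' = P') ∧ P'.degree = P.degree := by
  set T := (P.finite_setOf_restrict_eq (F' := F')).toFinset with hT
  have hsum := P.sum_ramification_mul_degree_eq (F' := F') T (P.mem_toFinset_restrict_eq_iff (F' := F'))
  have hmem : P' ∈ T := (P.mem_toFinset_restrict_eq_iff P').2 h
  have hpos : ∀ Q ∈ T, 0 < Q.ord (algebraMap F F' (P.uniformizer : F)) * (Q.degree : ℤ) := fun Q hQ => by
    have := Q.one_le_ord_algebraMap_uniformizer (K := K) (F := F)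
    rw [(P.mem_toFinset_restrict_eq_iff Q).1 hQ] at this
    have := PlaceOver.degree_pos_holds Q
    positivity
  have h2 : (P.degree : ℤ) ≤ P'.degree := by exact_mod_cast degree_le_degree_of_restrict_eq h
  have h3 : (0 : ℤ) < P.degree := by exact_mod_cast PlaceOver.degree_pos_holds P
  have hn : (0 : ℤ) < Module.finrank F F' := by exact_mod_cast Module.finrank_pos
  -- the term of `P'` alone already exhausts the sum
  have hrest : ∑ Q ∈ T.erase P', Q.ord (algebraMap F F' (P.uniformizer : F)) * (Q.degree : ℤ) =
      Module.finrank F F' * ((P.degree : ℤ) - P'.degree) := by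
    rw [← Finset.add_sum_erase T _ hmem, he] at hsum
    linarith
  have hrest0 : 0 ≤ ∑ Q ∈ T.erase P', Q.ord (algebraMap F F' (P.uniformizer : F)) * (Q.degree : ℤ) :=
    Finset.sum_nonneg fun Q hQ => (hpos Q (Finset.mem_of_mem_erase hQ)).le
  have hdeg : (P'.degree : ℤ) = P.degree := by nlinarith
  refine ⟨fun P'' hP'' => ?_, by exact_mod_cast hdeg⟩
  by_contra hne
  have hmem'' : P'' ∈ T.erase P' := Finset.mem_erase.2 ⟨hne, (P.mem_toFinset_restrict_eq_iff P'').2 hP''⟩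
  have h1 := Finset.single_le_sum (fun Q hQ => (hpos Q (Finset.mem_of_mem_erase hQ)).le) hmem''
  have h4 := hpos P'' (Finset.mem_of_mem_erase hmem'')
  rw [hrest, hdeg, sub_self, mul_zero] at h1
  exact absurd h1 (not_le.2 h4)

end PlaceOver

end Literature.NumberTheory.DiophantineGeometry.AlgFunctionField
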